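import Literature.Computability.Cryptography.ShorDiscreteLogQuantum
import Literature.Computability.Cryptography.OrderFindingPostSpec
import HarnessLib

/-!
# The post-processor of Shor's discrete-logarithm algorithm in integer arithmetic

Family `PQC` (trunk `CryptoQuantFine`); companion of `ShorDiscreteLogQuantum.lean`, the
specification half of the discharge of its programming fact `dlogPost_mem_FP` (the classical
post-processor `dlogPost` of Kitaev's discrete-logarithm experiment is polynomial time).
`dlogPost` is specified there mathematically — block counts over the layout equivalence
`dlLayout`, quadrant centres and the halving refinement `refined` over `ℚ`, `round`, and Mathlib's
Bézout coefficients `Nat.gcdA`/`Nat.gcdB` over `ℤ`. This file restates it, by proof, as a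
computation on natural numbers that the `FP` bricks of `Complexity/` realise literally
(`ShorDiscreteLogPostFP.lean`), reusing the integer refinement `OFPostCF.refineNat` /
`refineAux_eq` of the order-finding sibling (`OrderFindingPostSpec.lean`):

* `dlOff`, `val_dlLayout_symm`, `dlCnt_dlReadControls` — the layout is row-major, so block
  `(t, η, l, τ)` of the control read-out is the window of `dlBlockSize ℓ` bits at offset
  `dlOff ℓ (2t + η) l τ` of the measured string past the `ℓ` input wires, and `dlCnt` is its
  number of `1`s (Kitaev 1995, §3: "count how many 1's");
* `dlTb`, `dlKap`, `dlRef`, `dlPhaseEst_eq` — the phase estimate of generator-trial `u = 2t + η`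
  is the dyadic rational `refineNat κᵤ (ℓ+1) ℓ / (8 · 2^ℓ)` (Kitaev 1995, §3, Lemma 10);
* `roundMul_natCast_div` — `roundMul M (R/D) = ((2RM + D) / (2D)) mod M` (`round x = ⌊x + 1/2⌋`);
* `XgSt`, `xgStep`, `xgSteps_le`, `xgStep_iterate`, `xgStep_iterate_xgInit` — Mathlib's extended
  Euclid `Nat.xgcdAux` run with the Bézout coefficients **reduced modulo `M`** (the invariant
  `XgInv`), finished within `2 · size g` rounds (every two steps halve the divisor, CLRS
  Lemma 31.10), yielding `gcdA`, `gcdB` modulo `M`;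
* `solveStepM`, `foldl_solveStepM`, `solveCongr_eq_foldl_solveStepM` — the congruence solver of
  `ShorDiscreteLogQuantum.lean` on residues modulo `M ≥ 1`;
* `dlMod`, `dlRes`, `dlPairs`, `dlogEst_zero`, **`dlogPost_eq`** — the assembled closed form of
  `dlogPost` on every input (modulus `M = p - 1 = 0` gives `[]`).

## References

* A. Yu. Kitaev, *Quantum measurements and the Abelian Stabilizer Problem*,
  arXiv:quant-ph/9511026 (1995), §1 p. 5 (discrete logarithm from the stabilizer), §3 Lemma 10
  (the refinement "by a polynomial algorithm"), §4 p. 15 (post-processing "in a classical way").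
* P. W. Shor, SIAM J. Comput. 26 (1997) 1484–1509, §6 (discrete logarithms).
* D. E. Knuth, *The Art of Computer Programming*, Vol. 2, 3rd ed., 1998, §4.5.2 Algorithm X
  (extended Euclid; Mathlib's `Nat.xgcdAux`).
* T. H. Cormen, C. E. Leiserson, R. L. Rivest, C. Stein, *Introduction to Algorithms*, 3rd ed.
  2009, §31.2 (Lemma 31.10, Thm. 31.11: the number of recursive calls of EUCLID).
-/

noncomputable section

namespace Literature.Computability.Cryptography

namespace Kitaev1995

open _root_.Computability Complexity Finset OFPostCF

/-! ### The layout is row-major: blocks are contiguous segments -/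

/-- The offset of block `(t, η, l, τ)` among the control wires, for generator-trial index
`u = 2t + η`: `((u L + l) 2 + τ) B`. [folklore] -/
def dlOff (ℓ u l : ℕ) (τ : Bool) : ℕ := ((u * dlNumLevels ℓ + l) * 2 + τ.toNat) * dlBlockSize ℓ

/-- The inverse layout, retyped on `Fin (4 · (2 · (L · 2B)))` so that `simp` evaluates it. [folklore] -/
theorem dlLayout_symm_apply' {ℓ : ℕ} (p : DlTestLabel ℓ) :
    (dlLayout ℓ).symm p = ((finProdFinEquiv.symm.trans <| Equiv.prodCongr (Equiv.refl _) <|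
      finProdFinEquiv.symm.trans <| Equiv.prodCongr finTwoEquiv <|
        finProdFinEquiv.symm.trans <| Equiv.prodCongr (Equiv.refl _) <|
          finProdFinEquiv.symm.trans <| Equiv.prodCongr finTwoEquiv (Equiv.refl _)) :
          Fin (numTrials * (2 * (dlNumLevels ℓ * (2 * dlBlockSize ℓ)))) ≃ DlTestLabel ℓ).symm p := rfl

/-- **The position of control `(t, η, l, τ, i)`**: `dlOff ℓ (2t + η) l τ + i`. [folklore] -/
theorem val_dlLayout_symm {ℓ : ℕ} (t : Fin numTrials) (η : Bool) (l : Fin (dlNumLevels ℓ)) (τ : Bool)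
    (i : Fin (dlBlockSize ℓ)) :
    (((dlLayout ℓ).symm (t, η, l, τ, i) : Fin (dlNumControls ℓ)) : ℕ) = dlOff ℓ (2 * t + η.toNat) l τ + i := by
  rw [dlLayout_symm_apply']
  simp [val_finTwoEquiv_symm, dlOff]
  ring

/-- **A block count is the number of ones in a window of the measured string** past the `ℓ`
input wires. [cite: Kitaev1995, §3 (before Lemma 9: "count how many 1's")] -/
theorem dlCnt_dlReadControls (ℓ : ℕ) (y : List Bool) (t : Fin numTrials) (η : Bool) (l : Fin (dlNumLevels ℓ))
    (τ : Bool) :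
    dlCnt (t, η, l, τ) (dlReadControls ℓ y) =
      (((y.drop ℓ).drop (dlOff ℓ (2 * t + η.toNat) l τ)).take (dlBlockSize ℓ)).count true := by
  rw [dlCnt, dlBlock_eq_image, filter_image, card_image_of_injective _ fun i i' h => by simpa using h,
    List.drop_drop, count_take_drop_eq_sum, card_filter]
  refine Finset.sum_congr rfl fun i _ => ?_
  simp only [dlReadControls, val_dlLayout_symm]
  rw [show ℓ + (dlOff ℓ (2 * ↑t + η.toNat) ↑l τ + ↑i) = ℓ + dlOff ℓ (2 * ↑t + η.toNat) ↑l τ + ↑i by ring]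
  cases y.getD _ false <;> simp

/-! ### Level numerators and the phase estimate as a dyadic rational -/

/-- The test bit of block `(u, l, τ)` read off the control string `y'` (the measured string past
the `ℓ` input wires): `[2 · #{ones in the window} ≤ B]`. [cite: Kitaev1995, §3 (before Lemma 9)] -/
def dlTb (ℓ : ℕ) (y' : List Bool) (u l : ℕ) (τ : Bool) : Bool :=
  decide (2 * ((y'.drop (dlOff ℓ u l τ)).take (dlBlockSize ℓ)).count true ≤ dlBlockSize ℓ)

/-- The level numerator (over `8`) of generator-trial `u` at level `l`: `kq` of its two test
bits, `0` beyond the levels. [cite: Kitaev1995, §3 Lemma 10] -/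
def dlKap (ℓ : ℕ) (y' : List Bool) (u l : ℕ) : ℕ :=
  if l < dlNumLevels ℓ then kq (dlTb ℓ y' u l false) (dlTb ℓ y' u l true) else 0

/-- Level numerators are `< 8`. [folklore] -/
theorem dlKap_lt (ℓ : ℕ) (y' : List Bool) (u l : ℕ) : dlKap ℓ y' u l < 8 := by
  unfold dlKap; split_ifs
  · exact kq_lt _ _
  · norm_num

/-- The refined numerator of generator-trial `u`: `refineNat` of its level numerators, all
`ℓ + 1` levels deep (a number `< 8 · 2^ℓ`). [cite: Kitaev1995, §3 Lemma 10] -/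
def dlRef (ℓ : ℕ) (y' : List Bool) (u : ℕ) : ℕ := refineNat (dlKap ℓ y' u) (dlNumLevels ℓ) ℓ

/-- `dlRef < 8 · 2^ℓ`. [folklore] -/
theorem dlRef_lt (ℓ : ℕ) (y' : List Bool) (u : ℕ) : dlRef ℓ y' u < 8 * 2 ^ ℓ :=
  refineNat_lt (dlKap_lt ℓ y' u) _ _

/-- **The phase estimate as a dyadic rational**: `dlPhaseEst = dlRef / (8 · 2^ℓ)` for the
generator-trial `u = 2t + η`. [cite: Kitaev1995, §3 Lemma 10] -/
theorem dlPhaseEst_eq (ℓ : ℕ) (y : List Bool) (t : Fin numTrials) (η : Bool) :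
    dlPhaseEst ℓ (dlReadControls ℓ y) t η = (dlRef ℓ (y.drop ℓ) (2 * t + η.toNat) : ℚ) / (8 * 2 ^ ℓ) := by
  rw [dlPhaseEst, refined, dlRef, ← refineAux_eq (dlKap_lt ℓ (y.drop ℓ) _),
    show dlNumLevels ℓ - 1 = ℓ from rfl]
  congr 1
  funext l
  unfold dlKap dlLevelEst dlTb
  split_ifs with h
  · rw [quadrantCenter_eq, dlCnt_dlReadControls, dlCnt_dlReadControls]
  · simp

/-! ### Rounding in integers -/

/-- **`roundMul` on a fraction**: `roundMul M (R/D) = ((2RM + D) / (2D)) mod M` (`round x = ⌊x + 1/2⌋`).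
[folklore] -/
theorem roundMul_natCast_div (M R : ℕ) {D : ℕ} (hD : 0 < D) :
    roundMul M ((R : ℚ) / D) = (2 * R * M + D) / (2 * D) % M := by
  rw [roundMul, round_eq]
  have h : (R : ℚ) / D * M + 1 / 2 = ((2 * R * M + D : ℕ) : ℚ) / ((2 * D : ℕ) : ℚ) := by
    have hDq : (D : ℚ) ≠ 0 := by exact_mod_cast hD.ne'
    push_cast
    field_simp
  rw [h, Rat.floor_natCast_div_natCast, ← Int.natCast_div, ← Int.natCast_mod, Int.toNat_natCast]

/-! ### Extended Euclid run modulo `M` -/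

/-- State of the extended-Euclid loop (Mathlib's `Nat.xgcdAux k s t r' s' t'`) with the Bézout
coefficients reduced modulo `M`: `(k, r', s mod M, t mod M, s' mod M, t' mod M)`.
[Knuth, TAOCP vol. 2, §4.5.2 Algorithm X] [folklore] -/
structure XgSt where
  /-- the current divisor `k` -/
  k : ℕ
  /-- the current dividend `r'` -/
  r : ℕ
  /-- `s mod M` -/
  s : ℕ
  /-- `t mod M` -/
  t : ℕ
  /-- `s' mod M` -/
  s' : ℕ
  /-- `t' mod M` -/
  t' : ℕ

/-- One round of extended Euclid modulo `M` (identity once `k = 0`):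
`(k, r', s, t, s', t') ↦ (r' mod k, k, (s' + M - (q s mod M)) mod M, (t' + M - (q t mod M)) mod M, s, t)`,
`q = r' / k`. [Knuth, TAOCP vol. 2, §4.5.2 Algorithm X] [folklore] -/
def xgStep (M : ℕ) (σ : XgSt) : XgSt :=
  if σ.k = 0 then σ else
    ⟨σ.r % σ.k, σ.k, (σ.s' + M - σ.r / σ.k * σ.s % M) % M, (σ.t' + M - σ.r / σ.k * σ.t % M) % M, σ.s, σ.t⟩

/-- The number of recursive calls of `Nat.xgcdAux k … r' …` (Euclid on `(k, r')`). [folklore] -/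
def xgSteps : ℕ → ℕ → ℕ
  | 0, _ => 0
  | k + 1, r => xgSteps (r % (k + 1)) (k + 1) + 1
decreasing_by exact Nat.mod_lt _ (Nat.succ_pos _)

/-- `xgSteps` on a positive divisor unfolds once. [folklore] -/
theorem xgSteps_of_pos {k : ℕ} (hk : 0 < k) (r : ℕ) : xgSteps k r = xgSteps (r % k) k + 1 := by
  obtain ⟨k, rfl⟩ := Nat.exists_eq_succ_of_ne_zero hk.ne'
  rw [xgSteps]

/-- Two Euclid steps halve the divisor: `2 (a mod b) < a` for `0 < b < a`. [cite: CLRS2009, Lemma 31.10] -/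
theorem two_mul_mod_lt {a b : ℕ} (hb0 : 0 < b) (hb : b < a) : 2 * (a % b) < a := by
  by_cases h2 : 2 * b ≤ a
  · have := Nat.mod_lt a hb0; omega
  · have hq : a / b = 1 := by
      rw [Nat.div_eq_iff hb0]; omega
    have := Nat.div_add_mod a b
    rw [hq] at this
    omega

/-- **Lamé-type bound**: Euclid on `(k, r')` makes at most `2 · size k` recursive calls.
[cite: CLRS2009, Lemma 31.10 and Thm 31.11] -/
theorem xgSteps_le : ∀ k r : ℕ, xgSteps k r ≤ 2 * Nat.size k := by
  intro k
  induction k using Nat.strong_induction_on with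
  | _ k ih =>
    intro r
    rcases Nat.eq_zero_or_pos k with rfl | hk
    · simp [xgSteps]
    · have hsz : 0 < Nat.size k := Nat.size_pos.2 hk
      rw [xgSteps_of_pos hk]
      rcases Nat.eq_zero_or_pos (r % k) with h0 | h1
      · rw [h0, xgSteps]; omega
      · rw [xgSteps_of_pos h1]
        have hlt : r % k < k := Nat.mod_lt _ hk
        have ih' := ih (k % (r % k)) ((Nat.mod_lt _ h1).trans hlt) (r % k)
        -- the divisor after two steps is below `k / 2`, so its size drops
        have hsize : Nat.size (k % (r % k)) ≤ Nat.size k - 1 := by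
          rw [Nat.size_le]
          have h := two_mul_mod_lt h1 hlt
          have hk2 : k < 2 ^ Nat.size k := Nat.lt_size_self k
          have : 2 ^ Nat.size k = 2 * 2 ^ (Nat.size k - 1) := by
            rw [← pow_succ']; congr 1; omega
          omega
        omega

/-- The invariant of the loop modulo `M`: the state tracks `xgcdAux` with coefficients reduced
modulo `M`. [folklore] -/
structure XgInv (M : ℕ) (σ : XgSt) (k : ℕ) (s t : ℤ) (r' : ℕ) (s' t' : ℤ) : Prop where
  /-- the divisor is exact -/
  hk : σ.k = k
  /-- the dividend is exact -/
  hr : σ.r = r'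
  /-- `s` is tracked modulo `M` -/
  hs : (σ.s : ℤ) ≡ s [ZMOD M]
  /-- `t` is tracked modulo `M` -/
  ht : (σ.t : ℤ) ≡ t [ZMOD M]
  /-- `s'` is tracked modulo `M` -/
  hs' : (σ.s' : ℤ) ≡ s' [ZMOD M]
  /-- `t'` is tracked modulo `M` -/
  ht' : (σ.t' : ℤ) ≡ t' [ZMOD M]
  /-- the residues are reduced -/
  sl : σ.s < M
  /-- the residues are reduced -/
  tl : σ.t < M
  /-- the residues are reduced -/
  sl' : σ.s' < M
  /-- the residues are reduced -/
  tl' : σ.t' < M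

/-- The modular update `(a + M - (q b mod M)) mod M` is `a - q b` modulo `M`. [folklore] -/
theorem natCast_sub_mod_modEq {M a q b : ℕ} (hM : 0 < M) {A B : ℤ} (ha : (a : ℤ) ≡ A [ZMOD M])
    (hb : (b : ℤ) ≡ B [ZMOD M]) :
    (((a + M - q * b % M) % M : ℕ) : ℤ) ≡ A - q * B [ZMOD M] := by
  have hlt : q * b % M < M := Nat.mod_lt _ hM
  have h1 : (((a + M - q * b % M) % M : ℕ) : ℤ) = (((a : ℤ) + M - ((q * b % M : ℕ) : ℤ)) % (M : ℤ)) := by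
    rw [Int.natCast_mod, Nat.cast_sub (by omega)]; push_cast; rfl
  rw [h1]
  refine (Int.mod_modEq _ _).trans ?_
  have h2 : ((q * b % M : ℕ) : ℤ) ≡ q * B [ZMOD M] := by
    rw [Int.natCast_mod]
    refine (Int.mod_modEq _ _).trans ?_
    push_cast
    exact hb.mul_left _
  have h3 : ((a : ℤ) + M) ≡ A [ZMOD M] := by
    have : ((a : ℤ) + M) ≡ a + 0 [ZMOD M] := Int.ModEq.add_left _ (by simp [Int.ModEq])
    simpa using this.trans ha
  exact h3.sub h2

/-- **One round preserves the invariant** along `Nat.xgcdAux_rec`. [folklore] -/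
theorem XgInv.step {M : ℕ} (hM : 0 < M) {σ : XgSt} {k : ℕ} {s t : ℤ} {r' : ℕ} {s' t' : ℤ}
    (h : XgInv M σ k s t r' s' t') (hk : 0 < k) :
    XgInv M (xgStep M σ) (r' % k) (s' - (r' / k : ℕ) * s) (t' - (r' / k : ℕ) * t) k s t := by
  obtain ⟨rfl, rfl, hs, ht, hs', ht', sl, tl, sl', tl'⟩ := h
  have hne : σ.k ≠ 0 := hk.ne'
  refine ⟨?_, ?_, ?_, ?_, ?_, ?_, ?_, ?_, ?_, ?_⟩ <;> simp only [xgStep, hne, if_false]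
  · exact natCast_sub_mod_modEq hM hs' hs
  · exact natCast_sub_mod_modEq hM ht' ht
  · exact hs
  · exact ht
  · exact Nat.mod_lt _ hM
  · exact Nat.mod_lt _ hM
  · exact sl
  · exact tl

/-- A finished state (`k = 0`) is fixed. [folklore] -/
theorem xgStep_of_k_eq_zero {M : ℕ} {σ : XgSt} (h : σ.k = 0) : xgStep M σ = σ := by
  simp [xgStep, h]

/-- **The loop computes `xgcdAux` modulo `M`**: after at least `xgSteps k r'` rounds from a
state satisfying the invariant for `(k, s, t, r', s', t')`, the state is finished and satisfies
the invariant for `(0, _, _, xgcdAux k s t r' s' t')`. [Knuth, TAOCP vol. 2, §4.5.2 Algorithm X] [folklore] -/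
theorem xgStep_iterate {M : ℕ} (hM : 0 < M) : ∀ (n : ℕ) {σ : XgSt} {k : ℕ} {s t : ℤ} {r' : ℕ} {s' t' : ℤ},
    XgInv M σ k s t r' s' t' → xgSteps k r' ≤ n →
    ∃ s₁ t₁ : ℤ, XgInv M ((xgStep M)^[n] σ) 0 s₁ t₁ (Nat.xgcdAux k s t r' s' t').1
      (Nat.xgcdAux k s t r' s' t').2.1 (Nat.xgcdAux k s t r' s' t').2.2
  | 0, σ, k, s, t, r', s', t', h, hn => by
    rcases Nat.eq_zero_or_pos k with rfl | hk
    · exact ⟨s, t, by simpa using h⟩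
    · rw [xgSteps_of_pos hk] at hn; omega
  | n + 1, σ, k, s, t, r', s', t', h, hn => by
    rcases Nat.eq_zero_or_pos k with rfl | hk
    · refine ⟨s, t, ?_⟩
      rw [Function.iterate_fixed (xgStep_of_k_eq_zero h.hk)]
      simpa using h
    · rw [xgSteps_of_pos hk] at hn
      rw [Function.iterate_succ_apply, Nat.xgcdAux_rec hk]
      exact xgStep_iterate hM n (h.step hM hk) (by omega)

/-- The initial state `(g, c, 1 mod M, 0, 0, 1 mod M)` of the loop for `xgcd g c`. [folklore] -/
def xgInit (M g c : ℕ) : XgSt := ⟨g, c, 1 % M, 0, 0, 1 % M⟩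

/-- The initial state satisfies the invariant for `xgcdAux g 1 0 c 0 1`. [folklore] -/
theorem xgInv_xgInit {M : ℕ} (hM : 0 < M) (g c : ℕ) : XgInv M (xgInit M g c) g 1 0 c 0 1 := by
  refine ⟨rfl, rfl, ?_, ?_, ?_, ?_, Nat.mod_lt _ hM, hM, hM, Nat.mod_lt _ hM⟩ <;>
    simp [xgInit, Int.ModEq]

/-- **The Bézout coefficients modulo `M` from the loop**: after `n ≥ 2 · size g` rounds from
`xgInit M g c` the state is `(0, gcd g c, _, _, a, b)` with `a ≡ gcdA g c`, `b ≡ gcdB g c (mod M)`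
and `a, b < M`. [Knuth, TAOCP vol. 2, §4.5.2 Algorithm X] [folklore] -/
theorem xgStep_iterate_xgInit {M : ℕ} (hM : 0 < M) (g c n : ℕ) (hn : 2 * Nat.size g ≤ n) :
    ((xgStep M)^[n] (xgInit M g c)).k = 0 ∧ ((xgStep M)^[n] (xgInit M g c)).r = Nat.gcd g c ∧
    ((((xgStep M)^[n] (xgInit M g c)).s' : ℤ) ≡ Nat.gcdA g c [ZMOD M]) ∧
    ((((xgStep M)^[n] (xgInit M g c)).t' : ℤ) ≡ Nat.gcdB g c [ZMOD M]) ∧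
    ((xgStep M)^[n] (xgInit M g c)).s' < M ∧ ((xgStep M)^[n] (xgInit M g c)).t' < M := by
  obtain ⟨s₁, t₁, h⟩ := xgStep_iterate hM n (xgInv_xgInit hM g c) ((xgSteps_le g c).trans hn)
  rw [Nat.xgcdAux_val, Nat.xgcd_val] at h
  exact ⟨h.hk, h.hr, h.hs', h.ht', h.sl', h.tl'⟩

/-! ### The congruence solver modulo `M` -/

/-- One step of the congruence solver on residues: from `(g, e mod M)` and `(s, c)` to
`(gcd g s, (e a + c b) mod M)` for any `a ≡ gcdA g s`, `b ≡ gcdB g s (mod M)`. [folklore] -/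
theorem solveStep_modEq {M : ℕ} {g : ℕ} {e : ℤ} {eM s c a b : ℕ} (he : (eM : ℤ) ≡ e [ZMOD M])
    (ha : (a : ℤ) ≡ Nat.gcdA g s [ZMOD M]) (hb : (b : ℤ) ≡ Nat.gcdB g s [ZMOD M]) :
    (solveStep (g, e) (s, c)).1 = Nat.gcd g s ∧
      (((eM * a + c * b) % M : ℕ) : ℤ) ≡ (solveStep (g, e) (s, c)).2 [ZMOD M] := by
  refine ⟨rfl, ?_⟩
  rw [solveStep, Int.natCast_mod]
  refine (Int.mod_modEq _ _).trans ?_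
  push_cast
  exact (he.mul ha).add (hb.mul_left _)

/-! ### The congruence solver on residues -/

/-- **One step of the congruence solver as the machine runs it**: extended Euclid modulo `M`
for `n` rounds on `(g, s)`, then `(gcd, (e a + c b) mod M)` with the loop's coefficients `a, b`.
[cite: Kitaev1995, §1 p.5 (discrete logarithm from the stabilizer)] -/
def solveStepM (M n : ℕ) (ge : ℕ × ℕ) (sc : ℕ × ℕ) : ℕ × ℕ :=
  (((xgStep M)^[n] (xgInit M ge.1 sc.1)).r,
    (ge.2 * ((xgStep M)^[n] (xgInit M ge.1 sc.1)).s' + sc.2 * ((xgStep M)^[n] (xgInit M ge.1 sc.1)).t') % M)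

/-- **The residue fold tracks the integer fold**: with enough Euclid rounds, folding `solveStepM`
from `(g, e mod M)` gives the same `gcd`s as folding `solveStep` from `(g, e)` and a second
component congruent modulo `M` (and reduced). [folklore] -/
theorem foldl_solveStepM {M n : ℕ} (hM : 0 < M) : ∀ (l : List (ℕ × ℕ)) {g : ℕ} {e : ℤ} {eM : ℕ},
    0 < g → 2 * Nat.size g ≤ n → (eM : ℤ) ≡ e [ZMOD M] → eM < M →
    (l.foldl (solveStepM M n) (g, eM)).1 = (l.foldl solveStep (g, e)).1 ∧
    ((l.foldl (solveStepM M n) (g, eM)).2 : ℤ) ≡ (l.foldl solveStep (g, e)).2 [ZMOD M] ∧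
    (l.foldl (solveStepM M n) (g, eM)).2 < M
  | [], g, e, eM, _, _, he, hlt => ⟨rfl, he, hlt⟩
  | (s, c) :: l, g, e, eM, hg, hn, he, hlt => by
    obtain ⟨_, hr, ha, hb, _, _⟩ := xgStep_iterate_xgInit hM g s n hn
    obtain ⟨h1, h2⟩ := solveStep_modEq (c := c) he ha hb
    rw [List.foldl_cons, List.foldl_cons]
    have hg' : 0 < Nat.gcd g s := Nat.gcd_pos_of_pos_left _ hg
    have hsz : 2 * Nat.size (Nat.gcd g s) ≤ n :=
      le_trans (Nat.mul_le_mul_left 2 (Nat.size_le_size (Nat.gcd_le_left s hg))) hn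
    have e1 : solveStepM M n (g, eM) (s, c) = (Nat.gcd g s, (eM * ((xgStep M)^[n] (xgInit M g s)).s' +
        c * ((xgStep M)^[n] (xgInit M g s)).t') % M) := by
      simp only [solveStepM, hr]
    have e2 : solveStep (g, e) (s, c) = (Nat.gcd g s, (solveStep (g, e) (s, c)).2) :=
      Prod.ext h1 rfl
    rw [e1, e2]
    exact foldl_solveStepM hM l hg' hsz h2 (Nat.mod_lt _ hM)

/-- **The congruence solver on residues**: for `M ≥ 1` and `n ≥ 2 · size M` Euclid rounds,
`solveCongr M l` is the second component of the residue fold from `(M, 0)`. [folklore] -/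
theorem solveCongr_eq_foldl_solveStepM {M n : ℕ} (hM : 0 < M) (hn : 2 * Nat.size M ≤ n)
    (l : List (ℕ × ℕ)) : solveCongr M l = (l.foldl (solveStepM M n) (M, 0)).2 := by
  obtain ⟨_, h2, h3⟩ := foldl_solveStepM hM l hM hn (show ((0 : ℕ) : ℤ) ≡ 0 [ZMOD M] from rfl) hM
  rw [solveCongr]
  have : ((l.foldl solveStep ((M, 0) : ℕ × ℤ)).2 % (M : ℤ)) = ((l.foldl (solveStepM M n) (M, 0)).2 : ℤ) := by
    rw [← h2.eq]
    exact Int.emod_eq_of_lt (by positivity) (by exact_mod_cast h3)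
  rw [this, Int.toNat_natCast]

/-! ### The post-processor in closed form -/

/-- The modulus `M = p - 1` read off an instance string `w = ⟨p, ⟨g, y⟩⟩` (first component
decoded by Mathlib's `decodeNat`, as `dlogInstanceEncoding` does). [folklore] -/
def dlMod (w : List Bool) : ℕ := decodeNat (boolUnpair w).1 - 1

/-- `dlMod w < 2^{|w|}` (the first pair component has at most `|w|/2` symbols). [folklore] -/
theorem dlMod_lt (w : List Bool) : dlMod w < 2 ^ w.length := by
  rw [dlMod]
  have h0 := length_boolUnpair_parts_le w
  rcases Nat.eq_zero_or_pos (boolUnpair w).1.length with h | h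
  · rw [List.length_eq_zero_iff.1 h]
    simp [decodeNat, decodeNum]
  · have h1 := Literature.Computability.Cryptography.decodeNat_lt (boolUnpair w).1
    have h2 : 2 ^ ((boolUnpair w).1.length + 1) ≤ 2 ^ w.length := Nat.pow_le_pow_right (by norm_num) (by omega)
    omega

/-- `size (dlMod w) ≤ |w|`. [folklore] -/
theorem size_dlMod_le (w : List Bool) : Nat.size (dlMod w) ≤ w.length := Nat.size_le.2 (dlMod_lt w)

/-- The rounded residue of generator-trial `u`: `((2 R M + 2^{ℓ+3}) / 2^{ℓ+4}) mod M` with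
`R = dlRef ℓ y' u`, `M = dlMod w`, `ℓ = |w|` (`roundMul` of the phase estimate `R / 2^{ℓ+3}`).
[folklore] -/
def dlRes (w y' : List Bool) (u : ℕ) : ℕ :=
  (2 * dlRef w.length y' u * dlMod w + 2 ^ (w.length + 3)) / 2 ^ (w.length + 4) % dlMod w

/-- **Rounding the phase estimate in integers.** [folklore] -/
theorem roundMul_dlPhaseEst_eq (w y : List Bool) (t : Fin numTrials) (η : Bool) :
    roundMul (dlMod w) (dlPhaseEst w.length (dlReadControls w.length y) t η) =
      dlRes w (y.drop w.length) (2 * t + η.toNat) := by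
  rw [dlPhaseEst_eq, dlRes, show ((8 : ℚ) * 2 ^ w.length) = ((8 * 2 ^ w.length : ℕ) : ℚ) by push_cast; ring,
    roundMul_natCast_div _ _ (by positivity)]
  rw [show 8 * 2 ^ w.length = 2 ^ (w.length + 3) by rw [pow_add]; norm_num; ring,
    show 2 * 2 ^ (w.length + 3) = 2 ^ (w.length + 4) by rw [pow_succ]; ring]

/-- The residue pairs `(s_t, c_t) = (dlRes (2t), dlRes (2t+1))` of the four trials. [folklore] -/
def dlPairs (w y' : List Bool) : List (ℕ × ℕ) :=
  (List.range numTrials).map fun t => (dlRes w y' (2 * t), dlRes w y' (2 * t + 1))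

/-- The decoder of the instance triple never fails. [folklore] -/
theorem dlogInstanceEncoding_decode (w : List Bool) :
    dlogInstanceEncoding.decode w = some (decodeNat (boolUnpair w).1,
      decodeNat (boolUnpair (boolUnpair w).2).1, decodeNat (boolUnpair (boolUnpair w).2).2) := rfl

/-- With modulus `0` every rounded residue vanishes and the solver returns `0`. [folklore] -/
theorem dlogEst_zero (ℓ : ℕ) (γ : Fin (dlNumControls ℓ) → Bool) : dlogEst 0 ℓ γ = 0 := by
  have h0 : ∀ φ : ℚ, roundMul 0 φ = 0 := fun φ => by simp [roundMul]
  simp only [dlogEst, h0]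
  rw [show numTrials = 4 from rfl]
  simp [List.finRange_succ, solveCongr, solveStep]

/-- **The discrete-logarithm post-processor in closed form (integer arithmetic).** On every
input `z = ⟨w, y⟩` (`ℓ = |w|`, `M = dlMod w`, `y' = y` past the `ℓ` input wires): `[]` if `M = 0`,
else the numeral of the residue fold `solveStepM M (2ℓ+2)` over the four pairs of rounded
residues `dlRes`, started at `(M, 0)`. This is the specification the `FP` machine of
`dlogPost_mem_FP` is verified against. [cite: Kitaev1995, §1 p.5, §3 Lemma 10 and §4 p.15] -/
theorem dlogPost_eq (z : List Bool) :
    dlogPost z = (if dlMod (boolUnpair z).1 = 0 then [] else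
      encodeNat ((dlPairs (boolUnpair z).1 ((boolUnpair z).2.drop (boolUnpair z).1.length)).foldl
        (solveStepM (dlMod (boolUnpair z).1) (2 * (boolUnpair z).1.length + 2)) (dlMod (boolUnpair z).1, 0)).2) := by
  unfold dlogPost
  rw [dlogInstanceEncoding_decode]
  simp only
  rw [show decodeNat (boolUnpair (boolUnpair z).1).1 - 1 = dlMod (boolUnpair z).1 from rfl]
  split_ifs with hM
  · rw [hM, dlogEst_zero]; rfl
  · have hM' : 0 < dlMod (boolUnpair z).1 := Nat.pos_of_ne_zero hM
    rw [dlogEst, solveCongr_eq_foldl_solveStepM (n := 2 * (boolUnpair z).1.length + 2) hM'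
      (by have := size_dlMod_le (boolUnpair z).1; omega)]
    congr 3
    rw [dlPairs, ← List.map_coe_finRange_eq_range, List.map_map]
    refine List.map_congr_left fun t _ => ?_
    simp [roundMul_dlPhaseEst_eq]

end Kitaev1995

end Literature.Computability.Cryptography

end
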